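import Summits.Ventures.Crystal3D.Theorems.StickyWulffConstantGenericWallFloorTubeCount
import Summits.Ventures.Crystal3D.Theorems.StickyWulffConstantGenericWallFloorGeneralLedgerMid
import Summits.Ventures.Crystal3D.Theorems.StickyWulffConstantGenericWallFloorGeneralRung
import HarnessLib

/-!
# The general-filling rung of `stub_twoSlabAdhesion` for NON-CHAIN pairs (coherent walks in tubes)

HONEST FRAMING. Venture `Summits/Ventures/Crystal3D` (cell `crystal3d-full`), helper for the crux
`GenericWallFloor` (stmt-Ventures-19480) of `route-Ventures-StickyWulffConstant`, REGISTERED line `WallLedgerG`,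
open stub `stub_twoSlabAdhesion : TwoSlabAdhesion` (THE CRUX of the line).  Rung credit only; F-C1 not moved.

**Theorem (`general_twoSlabAdhesion_nonChain`).**  Inputs `KissingGap δ`, `KissingClassification δ` BY NAME
(discharged in the tree at `δ = 5/2`, computational grade).  Let `(A₁, t₁, A₂, t₂)` be a NON-CHAIN pair: some
set `𝓕` of linear isometries contains `A₁`, is closed under the `{111}` mirrors
`G ↦ (x ↦ G x − 2⟪G x, m⟫ m)` (`m` a unit normal with the slot menu `⟪G w, m⟫ ∈ {0, ±√(2/3)}`), and no
`G ∈ 𝓕` has `G(Λ₀) = A₂(Λ₀)` (this excludes exactly the countable family of `Σ3ⁿ`-related pairs, for which the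
stub is false without its `h`-term — cf-p1 §78 — and implies non-co-axiality).  Then with `R₀ = 20` and an
explicit `C`: for every `h ≥ 0`, `ρ ≥ 20`, every `1`-separated `X` in the cell with the clamped samples
`P₁ ⊆ Λ₁`, `P₂ ⊆ Λ₂` and CLEAN outer slivers, and ARBITRARY filling,
`cross(P₁, X∖P₁) + cross(P₂, (X∖P₁)∖P₂) ≤ D((X∖P₁)∖P₂) + (φ₁ + φ₂)·π·ρ² − (2/2809)·ρ² + C·(1 + h)·ρ`.
So the wall between two non-chain grains costs at least `(2/2809)ρ² ≈ πρ²/4412` whatever fills it.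

PROOF = ARCH v4: `card_midPayers_ge` (one steered coherent walk per vertical tube of radius `17`, axes on the
`37`-grid: `(2m+1)² ≥ (4ρ² − 372ρ)/2809` unsaturated balls at mid height) + `ledger_ge_faces_add_midPayers`
(outer faces + mid payers ≤ `Σ (12 − deg)`) + `affineSampleDeficit_upper` (the clamped slabs' own deficits)
+ the deficiency splits.  WHAT THIS IS NOT: not the stub — the constant is `2/2809`, not `1·π`, the outer slivers
are assumed clean, and chain pairs are excluded; F-C1 not moved.
-/

noncomputable section

namespace Summit.Ventures.Crystal3D.Theorems

open Summit.Ventures.Crystal3D Finset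
open Literature.MathematicalPhysics.StatisticalMechanics (fccStacking contactDeficiency)
open scoped InnerProductSpace

open scoped Classical in
/-- **The general-filling rung for non-chain pairs.**  See the module docstring. -/
theorem general_twoSlabAdhesion_nonChain {δ : ℝ} (hg : KissingGap δ) (hc : KissingClassification δ)
    (A₁ : EuclideanSpace ℝ (Fin 3) ≃ₗᵢ[ℝ] EuclideanSpace ℝ (Fin 3)) (t₁ : EuclideanSpace ℝ (Fin 3))
    (A₂ : EuclideanSpace ℝ (Fin 3) ≃ₗᵢ[ℝ] EuclideanSpace ℝ (Fin 3)) (t₂ : EuclideanSpace ℝ (Fin 3))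
    (𝓕 : Set (EuclideanSpace ℝ (Fin 3) ≃ₗᵢ[ℝ] EuclideanSpace ℝ (Fin 3))) (hA₁ : A₁ ∈ 𝓕)
    (havoid : ∀ G ∈ 𝓕, G '' fccStacking 1 (Real.sqrt (2 / 3)) ≠ A₂ '' fccStacking 1 (Real.sqrt (2 / 3)))
    (hclosed : ∀ G ∈ 𝓕, ∀ m : EuclideanSpace ℝ (Fin 3), ‖m‖ = 1 →
      (∀ w ∈ fccSlots, ⟪G w, m⟫_ℝ = 0 ∨ ⟪G w, m⟫_ℝ = Real.sqrt (2 / 3) ∨ ⟪G w, m⟫_ℝ = -Real.sqrt (2 / 3)) →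
      ∀ G' : EuclideanSpace ℝ (Fin 3) ≃ₗᵢ[ℝ] EuclideanSpace ℝ (Fin 3),
        (∀ x, G' x = G x - (2 * ⟪G x, m⟫_ℝ) • m) → G' ∈ 𝓕) :
    ∃ C R₀ : ℝ, 1 ≤ R₀ ∧ ∀ h : ℝ, 0 ≤ h → ∀ ρ : ℝ, R₀ ≤ ρ →
      ∀ X P₁ P₂ : Finset (EuclideanSpace ℝ (Fin 3)),
      (∀ p ∈ X, ∀ q ∈ X, p ≠ q → 1 ≤ dist p q) → P₁ ⊆ X → P₂ ⊆ X \ P₁ →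
      (∀ p ∈ X, -(2 * R₀) ≤ p 2 ∧ p 2 ≤ h + 2 * R₀ ∧ p 0 ^ 2 + p 1 ^ 2 ≤ ρ ^ 2) →
      (∀ p, p ∈ P₁ ↔ (p ∈ (fun q => A₁ q + t₁) '' fccStacking 1 (Real.sqrt (2 / 3)) ∧
        -(2 * R₀) ≤ p 2 ∧ p 2 ≤ -R₀ ∧ p 0 ^ 2 + p 1 ^ 2 ≤ ρ ^ 2)) →
      (∀ p, p ∈ P₂ ↔ (p ∈ (fun q => A₂ q + t₂) '' fccStacking 1 (Real.sqrt (2 / 3)) ∧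
        h + R₀ ≤ p 2 ∧ p 2 ≤ h + 2 * R₀ ∧ p 0 ^ 2 + p 1 ^ 2 ≤ ρ ^ 2)) →
      -- CLEAN outer slivers
      (∀ p ∈ X, p 2 < -(2 * R₀) + 1 → p ∈ (fun q => A₁ q + t₁) '' fccStacking 1 (Real.sqrt (2 / 3))) →
      (∀ p ∈ X, h + 2 * R₀ - 1 < p 2 → p ∈ (fun q => A₂ q + t₂) '' fccStacking 1 (Real.sqrt (2 / 3))) →
      ((((P₁ ×ˢ (X \ P₁)).filter fun pq => dist pq.1 pq.2 = 1).card : ℕ) : ℝ) +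
        ((((P₂ ×ˢ ((X \ P₁) \ P₂)).filter fun pq => dist pq.1 pq.2 = 1).card : ℕ) : ℝ) ≤
        contactDeficiency ((X \ P₁) \ P₂) +
          (Real.sqrt 2 / 4 * ∑ᶠ w ∈ {w ∈ fccStacking 1 (Real.sqrt (2 / 3)) | ‖w‖ = 1},
              |⟪w, A₁.symm (EuclideanSpace.single (2 : Fin 3) (1 : ℝ))⟫_ℝ| +
            Real.sqrt 2 / 4 * ∑ᶠ w ∈ {w ∈ fccStacking 1 (Real.sqrt (2 / 3)) | ‖w‖ = 1},
              |⟪w, A₂.symm (EuclideanSpace.single (2 : Fin 3) (1 : ℝ))⟫_ℝ|) * Real.pi * ρ ^ 2 -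
          2 / 2809 * ρ ^ 2 + C * (1 + h) * ρ := by
  obtain ⟨C₁, hC₁⟩ := affineSampleDeficit_upper A₁ t₁ 20 (by norm_num)
  obtain ⟨C₂, hC₂⟩ := affineSampleDeficit_upper A₂ t₂ 20 (by norm_num)
  refine ⟨(240 * Real.sqrt 2 * Real.pi + 3120 * (4 * 20 + 2)) / 2 + 1 + |C₁| + |C₂|, 20, by norm_num, ?_⟩
  intro h hh ρ hρ X P₁ P₂ hX hP₁X hP₂X hcell hP₁ hP₂ hclean₁ hclean₂
  set φ₁ : ℝ := Real.sqrt 2 / 4 * ∑ᶠ w ∈ {w ∈ fccStacking 1 (Real.sqrt (2 / 3)) | ‖w‖ = 1},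
      |⟪w, A₁.symm (EuclideanSpace.single (2 : Fin 3) (1 : ℝ))⟫_ℝ| with hφ₁
  set φ₂ : ℝ := Real.sqrt 2 / 4 * ∑ᶠ w ∈ {w ∈ fccStacking 1 (Real.sqrt (2 / 3)) | ‖w‖ = 1},
      |⟪w, A₂.symm (EuclideanSpace.single (2 : Fin 3) (1 : ℝ))⟫_ℝ| with hφ₂
  have hP₂X' : P₂ ⊆ X := hP₂X.trans Finset.sdiff_subset
  have hρ0 : (0 : ℝ) ≤ ρ := by linarith
  -- the ledger with mid payers
  have hled := ledger_ge_faces_add_midPayers A₁ t₁ A₂ t₂ X P₁ P₂ 20 h ρ (by norm_num) hh hρ hX hcell hP₁X hP₂X'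
    hP₁ hP₂ hclean₁ hclean₂
  rw [← finsum_unit_fcc_symm_eq_sum_slots A₁, ← finsum_unit_fcc_symm_eq_sum_slots A₂, ← hφ₁, ← hφ₂] at hled
  -- the tube count
  set m : ℕ := ⌊(ρ - 20) / 53⌋₊ with hm
  have hm0 : (0 : ℝ) ≤ (ρ - 20) / 53 := by apply div_nonneg <;> linarith
  have hmle : (m : ℝ) ≤ (ρ - 20) / 53 := Nat.floor_le hm0
  have hmlt : (ρ - 20) / 53 < (m : ℝ) + 1 := Nat.lt_floor_add_one _
  have hm53 : 53 * (m : ℝ) ≤ ρ - 20 := by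
    have := mul_le_mul_of_nonneg_left hmle (by norm_num : (0 : ℝ) ≤ 53)
    linarith [show (53 : ℝ) * ((ρ - 20) / 53) = ρ - 20 by field_simp]
  have hmsq : 2 * (37 * (m : ℝ)) ^ 2 ≤ (ρ - 20) ^ 2 := by
    have h0 : (0 : ℝ) ≤ 53 * (m : ℝ) := by positivity
    nlinarith
  have hcount := card_midPayers_ge hg hc X hX A₁ t₁ A₂ t₂ P₁ P₂ 20 h ρ (by norm_num) hρ (by linarith) hh hP₁X hP₂X'
    (fun p hp => (hcell p hp).2.1) hP₁ hP₂ hclean₂ 𝓕 hA₁ havoid hclosed m hmsq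
  -- the counted payers are ledger payers
  have hsub : (X.filter fun x => (X.filter fun q => dist x q = 1).card ≤ 11 ∧ -(20 : ℝ) - 2 ≤ x 2 ∧
        x 2 ≤ h + 20 + 3) ⊆
      (X.filter fun y => (X.filter fun q => dist y q = 1).card ≠ 12 ∧ -(20 : ℝ) - 2 ≤ y 2 ∧ y 2 ≤ h + 20 + 3) := by
    intro x hx
    rw [mem_filter] at hx ⊢
    exact ⟨hx.1, by have := hx.2.1; omega, hx.2.2.1, hx.2.2.2⟩
  have hcount' : ((2 * m + 1) ^ 2 : ℝ) ≤ ((X.filter fun y => (X.filter fun q => dist y q = 1).card ≠ 12 ∧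
      -(20 : ℝ) - 2 ≤ y 2 ∧ y 2 ≤ h + 20 + 3).card : ℝ) := by
    have := hcount.trans (card_le_card hsub)
    exact_mod_cast this
  -- `(2m+1)² ≥ (4ρ² − 372ρ)/2809`
  have hpay : (4 * ρ ^ 2 - 372 * ρ) / 2809 ≤ ((2 * m + 1) ^ 2 : ℝ) := by
    have h1 : (2 * ρ - 93) / 53 < 2 * (m : ℝ) + 1 := by
      have : 2 * ((ρ - 20) / 53) < 2 * (m : ℝ) + 2 := by linarith
      have e : (2 * ρ - 93) / 53 = 2 * ((ρ - 20) / 53) - 1 := by field_simp; ring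
      rw [e]; linarith
    by_cases hρ93 : 93 ≤ 2 * ρ
    · have h0 : 0 ≤ (2 * ρ - 93) / 53 := by apply div_nonneg <;> linarith
      have h2 : ((2 * ρ - 93) / 53) ^ 2 ≤ (2 * (m : ℝ) + 1) ^ 2 := by nlinarith
      have e : ((2 * ρ - 93) / 53) ^ 2 = (4 * ρ ^ 2 - 372 * ρ + 8649) / 2809 := by field_simp; ring
      rw [e] at h2
      have : (4 * ρ ^ 2 - 372 * ρ) / 2809 ≤ (4 * ρ ^ 2 - 372 * ρ + 8649) / 2809 := by
        apply div_le_div_of_nonneg_right _ (by norm_num); linarith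
      linarith
    · push Not at hρ93
      have : (4 * ρ ^ 2 - 372 * ρ) / 2809 ≤ 0 := by
        apply div_nonpos_of_nonpos_of_nonneg _ (by norm_num); nlinarith
      have h0 : (0 : ℝ) ≤ (2 * (m : ℝ) + 1) ^ 2 := sq_nonneg _
      linarith
  -- the two upper slab counts and the two splits
  have hD₁ := hC₁ (-(2 * 20)) (-20) (by ring) ρ hρ P₁ hP₁
  have hD₂ := hC₂ (h + 20) (h + 2 * 20) (by ring) ρ hρ P₂ hP₂
  have hsplit₁ := contactDeficiency_sdiff_split hP₁X
  have hsplit₂ := contactDeficiency_sdiff_split hP₂X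
  have htwo := two_mul_contactDeficiency_eq_sum X
  -- constants
  have hb : C₁ * ρ ≤ |C₁| * (1 + h) * ρ := by
    have h1 : 0 ≤ (|C₁| - C₁) * ρ := mul_nonneg (by linarith only [le_abs_self C₁]) hρ0
    have h2 : 0 ≤ |C₁| * h * ρ := by positivity
    linarith only [h1, h2]
  have hc' : C₂ * ρ ≤ |C₂| * (1 + h) * ρ := by
    have h1 : 0 ≤ (|C₂| - C₂) * ρ := mul_nonneg (by linarith only [le_abs_self C₂]) hρ0
    have h2 : 0 ≤ |C₂| * h * ρ := by positivity
    linarith only [h1, h2]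
  have hhρ : 0 ≤ h * ρ := mul_nonneg hh hρ0
  have hlin : (372 / 2809 / 2 : ℝ) * ρ ≤ 1 * (1 + h) * ρ := by nlinarith
  linarith only [hled, hcount', hpay, hD₁, hD₂, hsplit₁, hsplit₂, htwo, hb, hc', hρ0, hh, hhρ, hlin]

end Summit.Ventures.Crystal3D.Theorems

end
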